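import Literature.NumberTheory.EllipticCurves.NewformOpenImageEngineProofs
import Literature.NumberTheory.EllipticCurves.NewformOpenImageCliffordProofs
import Literature.NumberTheory.EllipticCurves.NewformOpenImageNebentypusProofs
import Literature.NumberTheory.EllipticCurves.NewformGaloisRepDetProofs
import Literature.NumberTheory.EllipticCurves.DeligneSerreWeightOneIrreducibleKroneckerWeberProofs
import Literature.NumberTheory.GaloisRepresentations.KroneckerWeberTheorem
import Literature.NumberTheory.GaloisRepresentations.FrobeniusDensity
import Literature.NumberTheory.GaloisRepresentations.OddAbsolutelyIrreducibleProofs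
import Literature.NumberTheory.Automorphic.ChebotarevArtinRepHolds
import Literature.NumberTheory.EllipticCurves.NewformGaloisRepRibetThm23Proofs
import HarnessLib

/-!
# Open image, IX: the open-image theorem for rational non-CM newforms from Ribet's Thm. (2.3)
(proofs file)

Theorems only.  This file assembles the proof of the named fact
`momose_isOpen_range_galoisRep` (`NewformOpenImage.lean`; Ribet 1985, Introduction (1) and §3,
after Serre, Swinnerton-Dyer, Ribet 1977 and Momose 1981):

* `OpenImage.momose_isOpen_range_galoisRep_of_thm23` — `(∀ N k, thm23_isIrreducible) →
  momose_isOpen_range_galoisRep`, from Ribet 1977, Thm. (2.3) (irreducibility of the `λ`-adic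
  representations attached to a newform) as a hypothesis;
* `momose_isOpen_range_galoisRep_holds` — **the discharge**, using the tree's proof
  `Ribet1977.thm23_isIrreducible_holds` (`NewformGaloisRepRibetThm23Proofs`).

Ingredients (all proved in the tree): the `ℓ`-adic Lie engine
(`NewformOpenImageExpProofs`, `…LieProofs`, `…LieAlgebraProofs`, `…EngineProofs`: for
`G ≤ GL₂(ℤ_ℓ)`, no invariant line on `G ∩ Γ(ℓ³)` over `\bar ℚ_ℓ` plus an element of determinant
`≠ 1` give all classes of `Γ(ℓˢ)/Γ(ℓ^{s+1})` at one level) and successive approximation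
(`NewformOpenImageProofs`, Serre IV-23); Clifford theory in dimension `2`
(`NewformOpenImageCliffordProofs`); `ε = 1`, `k` even, `a_p ∈ ℚ`, `a_p² ≠ 4p^{k−1}`
(`NewformOpenImageNebentypusProofs`; Ribet 1977 (3.3), Thm. (4.3)); the Dirichlet character of a
character of `Γ_ℚ` with open kernel (`exists_dirichletCharacter_of_kroneckerWeber` with the proved
Kronecker–Weber theorem `KroneckerWeber_holds`); `det ρ_f` and
`tr ρ_f` at Frobenius from the Hecke polynomial (`IsGaloisRepOfNewform1`), absolute
irreducibility from Thm. (2.3) (`Ribet1977.isAbsolutelyIrreducible_of_thm23`), existence and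
density of Frobenius elements (`frobenius_dense` with `chebotarev_artinRep_holds`).

Also: `OpenImage.trace_eq_of_charpoly_eq`, `OpenImage.isOpen_normalCore` (the normal core of an
open subgroup of finite index is open), `OpenImage.exists_not_eigenline_of_isAbsolutelyIrreducible`,
`OpenImage.trace_det_frob` (`tr ρ(Frob_p) = a_p ∈ ℚ`, `det ρ(Frob_p) = p^{k−1}` when `ε = 1`).

## References

* K. A. Ribet, *On ℓ-adic representations attached to modular forms II*, Glasgow Math. J. 27
  (1985) 185–194: Introduction (1); §3, p. 191 (Momose's theorem). [Ribet1985]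
* K. A. Ribet, *Galois representations attached to eigenforms with Nebentypus*, LNM 601 (1977),
  Thm. (2.3), §4 (Thm. (4.3), Prop. (4.4), Thm. (4.5)), Thm. (5.7). [Ribet1977Nebentypus]
* F. Momose, On the ℓ-adic representations attached to modular forms, J. Fac. Sci. Univ. Tokyo
  28 (1981) 89–109. [Momose1981]
* J.-P. Serre, *Abelian ℓ-adic representations and elliptic curves*, Benjamin 1968, Ch. IV.
  [SerreAbelianLadic1968]
-/

noncomputable section

open scoped MatrixGroups ModularForm NumberField Matrix

open CongruenceSubgroup UpperHalfPlane Polynomial IsDedekindDomain Field Filter Topology NormedSpace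

namespace Literature.NumberTheory.EllipticCurves.ModularForms

namespace OpenImage

open Rat.HeightOneSpectrum GaloisRepresentations Literature.GroupTheory.Index

variable {N : ℕ} [NeZero N] {k : ℤ}

/-! ### Linear algebra: trace from the characteristic polynomial, scalars -/

/-- The trace of a `2 × 2` matrix with characteristic polynomial `X² − a X + b` is `a`. Duplicate
(with a superfluous `Nontrivial R`) of `trace_eq_of_charpoly_eq_fin_two`
(`NewformGaloisRepRibetThm23Proofs`, in the import closure); deprecated restatement (dedup-01116,
2026-08-16). [folklore] -/
@[deprecated trace_eq_of_charpoly_eq_fin_two (since := "2026-08-16")]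
theorem trace_eq_of_charpoly_eq {R : Type*} [CommRing R] [Nontrivial R]
    {M : Matrix (Fin 2) (Fin 2) R} {a b : R} (h : M.charpoly = X ^ 2 - C a * X + C b) :
    M.trace = a :=
  trace_eq_of_charpoly_eq_fin_two h

/-- Trace of a base-changed matrix. [folklore] -/
theorem trace_map_fin_two {R S : Type*} [CommRing R] [CommRing S] (f : R →+* S) (M : Matrix (Fin 2) (Fin 2) R) :
    (M.map f).trace = f M.trace := by
  rw [Matrix.trace_fin_two, Matrix.trace_fin_two, Matrix.map_apply, Matrix.map_apply, map_add]

/-! ### Topological groups: open subgroups of finite index -/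

/-- The normal core of an open subgroup of finite index is open (it is the intersection of the
finitely many conjugates). [folklore] -/
theorem isOpen_normalCore {Γ : Type*} [Group Γ] [TopologicalSpace Γ] [IsTopologicalGroup Γ]
    (P : Subgroup Γ) (hP : IsOpen (P : Set Γ)) [P.FiniteIndex] : IsOpen (P.normalCore : Set Γ) := by
  haveI : Finite (Γ ⧸ P) := Subgroup.finite_quotient_of_finiteIndex
  have hset : (P.normalCore : Set Γ) = ⋂ q : Γ ⧸ P, (fun a ↦ (Quotient.out q)⁻¹ * a * Quotient.out q) ⁻¹' (P : Set Γ) := by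
    have hmemcore : ∀ a, a ∈ P.normalCore ↔ ∀ b : Γ, b * a * b⁻¹ ∈ P := fun a ↦ Iff.rfl
    ext a
    simp only [SetLike.mem_coe, hmemcore, Set.mem_iInter, Set.mem_preimage]
    constructor
    · intro h q
      have := h (Quotient.out q)⁻¹
      rwa [inv_inv] at this
    · intro h b
      -- `b⁻¹ = out(q) * p` with `p ∈ P`, `q = [b⁻¹]`
      set q : Γ ⧸ P := QuotientGroup.mk b⁻¹ with hq
      have hp : (Quotient.out q)⁻¹ * b⁻¹ ∈ P := by
        rw [← QuotientGroup.eq, QuotientGroup.out_eq', hq]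
      have key : b * a * b⁻¹ = ((Quotient.out q)⁻¹ * b⁻¹)⁻¹ * ((Quotient.out q)⁻¹ * a * Quotient.out q) *
          ((Quotient.out q)⁻¹ * b⁻¹) := by group
      rw [key]
      exact P.mul_mem (P.mul_mem (P.inv_mem hp) (h q)) hp
  rw [hset]
  refine isOpen_iInter_of_finite fun q ↦ hP.preimage ?_
  exact (continuous_const.mul continuous_id).mul continuous_const

/-! ### The invariant line of an absolutely irreducible plane representation does not exist -/

/-- An absolutely irreducible framed plane representation has no invariant line over any field
extension `f : A → B` of the coefficients. [folklore] -/
theorem exists_not_eigenline_of_isAbsolutelyIrreducible {G : Type*} [Group G] [TopologicalSpace G]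
    {A : Type} [Field A] [TopologicalSpace A] {ρ : FramedRep G A 2} (h : ρ.IsAbsolutelyIrreducible)
    {B : Type} [Field B] (f : A →+* B) (w : Fin 2 → B) (hw : w ≠ 0) :
    ∃ γ : G, ¬ ∃ c : B, (((ρ γ : GL (Fin 2) A) : Matrix (Fin 2) (Fin 2) A).map f) *ᵥ w = c • w := by
  by_contra hall
  push Not at hall
  have hirr := h B f
  set ρB := ρ.baseChangeRepresentation f with hρB
  have hρBapply : ∀ (g : G) (x : Fin 2 → B),
      ρB g x = (((ρ g : GL (Fin 2) A) : Matrix (Fin 2) (Fin 2) A).map f) *ᵥ x := fun g x ↦ rfl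
  -- the line `B w` as a subrepresentation
  let W : Subrepresentation ρB :=
    { toSubmodule := Submodule.span B {w}
      apply_mem_toSubmodule := by
        intro g x hx
        obtain ⟨a, rfl⟩ := Submodule.mem_span_singleton.1 hx
        obtain ⟨c, hc⟩ := hall g
        rw [hρBapply, Matrix.mulVec_smul, hc, smul_smul]
        exact Submodule.mem_span_singleton.2 ⟨a * c, rfl⟩ }
  haveI := hirr
  rcases eq_bot_or_eq_top W with hbot | htop
  · have hmem : w ∈ W.toSubmodule := Submodule.mem_span_singleton_self w
    have h0 : W.toSubmodule = ⊥ := congrArg Subrepresentation.toSubmodule hbot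
    rw [h0, Submodule.mem_bot] at hmem
    exact hw hmem
  · have h1 : Module.finrank B W.toSubmodule = 1 := finrank_span_singleton hw
    have h2 : W.toSubmodule = ⊤ := congrArg Subrepresentation.toSubmodule htop
    rw [h2, finrank_top, Module.finrank_fin_fun] at h1
    norm_num at h1

/-! ### Frobenius data of `ρ_f` for a rational newform with `ε = 1` -/

/-- For `ρ` attached to `f` away from `N ℓ`, with `ε_f = 1` and `K_f = ⊥`: at an arithmetic
Frobenius `σ` above a prime `p ∤ N ℓ`, `tr ρ(σ) = a_p` — a rational number `r` with
`ι(a_p) = r` — and `det ρ(σ) = p^{k−1}`. [folklore] -/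
theorem trace_det_frob {f : CuspForm (Gamma1 N) k} {ℓ : ℕ} [Fact ℓ.Prime] {ι : coeffCharField f →+* ℚ_[ℓ]}
    {ρ : FramedGaloisRep ℚ ℚ_[ℓ] 2} (hρ : IsGaloisRepOfNewform1 f ι {p | p ∣ N * ℓ} ρ)
    (hQ : coeffCharField f = ⊥) (hε : nebentypus f = 1) {m : ℕ} (hm : ((m : ℕ) : ℤ) = k - 1)
    {v : HeightOneSpectrum (𝓞 ℚ)} (hv : ¬ ((primesEquiv v : Nat.Primes) : ℕ) ∣ N * ℓ)
    {𝔓 : Ideal (absIntegers (𝓞 ℚ) ℚ)} (h𝔓 : 𝔓 ∈ v.primesAbove) {σ : absoluteGaloisGroup ℚ}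
    (hσ : IsArithFrobAt (𝓞 ℚ) σ 𝔓) :
    (∃ r : ℚ, (r : ℂ) = cuspCoeff f ((primesEquiv v : Nat.Primes) : ℕ) ∧
        ((ρ σ : GL (Fin 2) ℚ_[ℓ]) : Matrix (Fin 2) (Fin 2) ℚ_[ℓ]).trace = (r : ℚ_[ℓ])) ∧
      ((ρ σ : GL (Fin 2) ℚ_[ℓ]) : Matrix (Fin 2) (Fin 2) ℚ_[ℓ]).det =
        ((((primesEquiv v : Nat.Primes) : ℕ) : ℚ_[ℓ])) ^ m := by
  set p : ℕ := ((primesEquiv v : Nat.Primes) : ℕ) with hpdef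
  have hpN : ¬ p ∣ N := fun h ↦ hv (h.mul_right ℓ)
  obtain ⟨-, hchar⟩ := hρ v hv
  have hc := hchar 𝔓 h𝔓 σ hσ
  rw [← hpdef, map_heckePolynomial_eq f ι p hm] at hc
  -- `ε(p) = 1` in `K_f`
  have hεp : nebentypusCoeff f (p : ZMod N) = 1 := by
    apply Subtype.ext
    rw [coe_nebentypusCoeff, hε]
    have hu : IsUnit (p : ZMod N) := (ZMod.isUnit_iff_coprime p N).2
      ((Nat.Prime.coprime_iff_not_dvd (primesEquiv v).2).2 hpN)
    rw [MulChar.one_apply hu]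
    rfl
  -- `a_p` is rational
  obtain ⟨r, hr⟩ := exists_ratCast_eq_cuspCoeff_of_coeffCharField_eq_bot hQ p
  refine ⟨⟨r, hr, ?_⟩, ?_⟩
  · rw [trace_eq_of_charpoly_eq_fin_two hc]
    have he : (⟨(qExpansion 1 ⇑f).coeff p, cuspCoeff_mem_coeffCharField f p⟩ : coeffCharField f) =
        (r : coeffCharField f) := by
      apply Subtype.ext
      rw [SubfieldClass.coe_ratCast]
      exact hr.symm
    rw [he, map_ratCast]
  · rw [Matrix.det_eq_of_charpoly_eq hc, hεp, map_one, one_mul]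

/-! ### The open-image theorem from Ribet 1977, Thm. (2.3) -/

/-- **Open image for rational non-CM newforms, from Ribet's irreducibility theorem.**  Granting
the named fact `Ribet1977.thm23_isIrreducible` (Ribet 1977, Thm. (2.3): the `λ`-adic
representations attached to a newform are irreducible over the coefficient field) at every level
and weight, the statement `momose_isOpen_range_galoisRep` holds: for a newform `f ∈ S_k(Γ₁(N))`,
`k ≥ 2`, with `K_f = ℚ` and without complex multiplication, every continuous
`ρ : Γ_ℚ → GL₂(ℚ_ℓ)` attached to `f` away from `N ℓ` has open image.

Proof (Ribet 1977, §4–§5 and Ribet 1985, §3, after Serre and Momose), as formalised in the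
`NewformOpenImage*Proofs` files.  Put `G = ι⁻¹(ρ(Γ_ℚ)) ≤ GL₂(ℤ_ℓ)`.  By the `ℓ`-adic Lie engine
(`exists_meets_of_forall_exists_not_eigenline_of_det_ne_one`: exponential, Lie lattice, `2 × 2`
Lie algebras) and successive approximation (`isOpen_range_of_meets`) it suffices that
(1) `G ∩ Γ(ℓ³)` has no invariant line over `E = \bar ℚ_ℓ` and (2) contains an element of
determinant `≠ 1`.  `K_f = ℚ` and non-CM give `ε = 1` and `k` even
(`nebentypus_eq_one_of_coeffCharField_eq_bot`), so `det ρ(Frob_p) = p^{k−1}` and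
`tr ρ(Frob_p) = a_p ∈ ℚ`.  (2): the open subgroup `U = ρ⁻¹(ι Γ(ℓ³))` has finite index, and
`det ρ(Frob_p)^n = p^{n(k−1)} ≠ 1`.  (1): if `v` were a common eigenvector of `ρ(U)`, then of
`ρ(V)`, `V` the (open, normal) core of `U`; `ρ` is absolutely irreducible
(`Ribet1977.isAbsolutelyIrreducible_of_thm23`), so by Clifford theory
(`scalar_or_index_two_of_eigenline`) either `ρ(V)` is scalar — then a Frobenius in `V`
(Chebotarev, `frobenius_dense`) gives `a_p² = 4 p^{k−1}`, impossible for `k` even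
(`sq_ne_four_mul_prime_pow`; Ribet's Thm. (4.3)) — or the stabiliser `H ⊇ V` of `E v` has index
`2` with `tr ρ = 0` off `H`; `H` is open, so by Kronecker–Weber
(`exists_dirichletCharacter_of_kroneckerWeber` applied to the sign character of `H`) there is a
Dirichlet character `η ≠ 1` with `η(p) = −1` exactly when `Frob_p ∉ H`, where `a_p = 0`: thus
`η(p) a_p = a_p` for all `p ∤ 2Nℓ`, i.e. `f` has complex multiplication (Ribet's Prop. (4.4)),
contradiction. [cite: Ribet1985, §3 p. 191 (Momose's theorem) and Introduction (1)]
[cite: Ribet1977Nebentypus, Thm. (2.3), §4 (Thm. (4.3), Prop. (4.4)), Thm. (5.7)] -/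
theorem momose_isOpen_range_galoisRep_of_thm23
    (h23 : ∀ (N : ℕ) [NeZero N] (k : ℤ), Ribet1977.thm23_isIrreducible (N := N) (k := k)) :
    momose_isOpen_range_galoisRep := by
  intro N _ k f hk hf hQ hCM ℓ _ ι ρ hρ
  classical
  have hℓ : ℓ.Prime := Fact.out
  -- arithmetic of `f`: `ε = 1`, `k` even, `k - 1 = m` odd
  have hε : nebentypus f = 1 := hf.nebentypus_eq_one_of_coeffCharField_eq_bot hQ hCM
  have hkeven : Even k := hf.even_of_nebentypus_eq_one hε
  obtain ⟨m, hm⟩ : ∃ m : ℕ, ((m : ℕ) : ℤ) = k - 1 := ⟨(k - 1).toNat, Int.toNat_of_nonneg (by omega)⟩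
  have hmodd : Odd m := by
    rcases Nat.even_or_odd m with h | h
    · exfalso
      obtain ⟨j, hj⟩ := h
      obtain ⟨i, hi⟩ := hkeven
      omega
    · exact h
  have hm1 : 1 ≤ m := by omega
  -- the subgroup `G = ι⁻¹(ρ(Γ_ℚ)) ≤ GL₂(ℤ_ℓ)` and its members
  set G : Subgroup (GL (Fin 2) ℤ_[ℓ]) :=
    (ρ.toMonoidHom.range).comap (Matrix.GeneralLinearGroup.map (PadicInt.Coe.ringHom (p := ℓ))) with hG
  have hmemG : ∀ {g : GL (Fin 2) ℤ_[ℓ]}, g ∈ G ↔ ∃ τ, ρ τ = Matrix.GeneralLinearGroup.map (PadicInt.Coe.ringHom (p := ℓ)) g := by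
    intro g
    rw [hG, Subgroup.mem_comap, MonoidHom.mem_range]
    rfl
  -- the open subgroup `U = ρ⁻¹(ι Γ(ℓ³))` of `Γ_ℚ`, of finite index
  set U : Subgroup (absoluteGaloisGroup ℚ) :=
    ((GL2.congruenceSubgroup (p := ℓ) 3).map (Matrix.GeneralLinearGroup.map (PadicInt.Coe.ringHom (p := ℓ)))).comap
      ρ.toMonoidHom with hU
  have hmemU : ∀ {τ}, τ ∈ U ↔ ∃ g ∈ GL2.congruenceSubgroup (p := ℓ) 3,
      Matrix.GeneralLinearGroup.map (PadicInt.Coe.ringHom (p := ℓ)) g = ρ τ := by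
    intro τ
    rw [hU, Subgroup.mem_comap, Subgroup.mem_map]
    rfl
  have hUopen : IsOpen (U : Set (absoluteGaloisGroup ℚ)) := by
    have h := isOpen_of_map_congruenceSubgroup_le (ℓ := ℓ) (m := 3) (by norm_num)
      (S := (GL2.congruenceSubgroup (p := ℓ) 3).map (Matrix.GeneralLinearGroup.map (PadicInt.Coe.ringHom (p := ℓ)))) le_rfl
    exact h.preimage (map_continuous ρ)
  haveI : Finite (absoluteGaloisGroup ℚ ⧸ U) := Subgroup.quotient_finite_of_isOpen U hUopen
  haveI hUfi : U.FiniteIndex := Subgroup.finiteIndex_of_finite_quotient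
  -- a good prime `p₀ ∤ N ℓ` and a Frobenius at it
  have hgood : ∀ {v : HeightOneSpectrum (𝓞 ℚ)}, ¬ ((primesEquiv v : Nat.Primes) : ℕ) ∣ N * ℓ →
      ∀ {𝔓 : Ideal (absIntegers (𝓞 ℚ) ℚ)}, 𝔓 ∈ v.primesAbove → ∀ {σ : absoluteGaloisGroup ℚ},
        IsArithFrobAt (𝓞 ℚ) σ 𝔓 →
        (∃ r : ℚ, (r : ℂ) = cuspCoeff f ((primesEquiv v : Nat.Primes) : ℕ) ∧
          ((ρ σ : GL (Fin 2) ℚ_[ℓ]) : Matrix (Fin 2) (Fin 2) ℚ_[ℓ]).trace = (r : ℚ_[ℓ])) ∧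
        ((ρ σ : GL (Fin 2) ℚ_[ℓ]) : Matrix (Fin 2) (Fin 2) ℚ_[ℓ]).det =
          ((((primesEquiv v : Nat.Primes) : ℕ) : ℚ_[ℓ])) ^ m :=
    fun hv _ h𝔓 _ hσ ↦ trace_det_frob hρ hQ hε hm hv h𝔓 hσ
  /- (2) an element of `G ∩ Γ(ℓ³)` of determinant `≠ 1` -/
  have hdet : ∃ g ∈ G, g ∈ GL2.congruenceSubgroup (p := ℓ) 3 ∧ (g : Matrix (Fin 2) (Fin 2) ℤ_[ℓ]).det ≠ 1 := by
    by_contra hall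
    push Not at hall
    -- a prime `p₀ > N ℓ` and a Frobenius `σ₀` at it
    obtain ⟨p₀, hp₀ge, hp₀⟩ := Nat.exists_infinite_primes (N * ℓ + 1)
    have hp₀Nℓ : ¬ p₀ ∣ N * ℓ := fun h ↦ by
      have := Nat.le_of_dvd (Nat.pos_of_ne_zero (mul_ne_zero (NeZero.ne N) hℓ.ne_zero)) h
      omega
    set v₀ : HeightOneSpectrum (𝓞 ℚ) := primesEquiv.symm ⟨p₀, hp₀⟩ with hv₀
    have hpv₀ : ((primesEquiv v₀ : Nat.Primes) : ℕ) = p₀ := by rw [hv₀, Equiv.apply_symm_apply]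
    obtain ⟨𝔓, h𝔓⟩ := HeightOneSpectrum.primesAbove_nonempty v₀
    obtain ⟨σ₀, hσ₀⟩ := HeightOneSpectrum.exists_isArithFrobAt_of_mem_primesAbove_holds (K := ℚ) (v := v₀) h𝔓
    obtain ⟨-, hdet₀⟩ := hgood (v := v₀) (by rw [hpv₀]; exact hp₀Nℓ) h𝔓 hσ₀
    rw [hpv₀] at hdet₀
    -- `σ₀ⁿ ∈ U`
    obtain ⟨n, hn, -, hσ₀n⟩ := Subgroup.exists_pow_mem_of_index_ne_zero hUfi.index_ne_zero σ₀
    obtain ⟨g, hg3, hgσ⟩ := hmemU.1 hσ₀n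
    have hgG : g ∈ G := hmemG.2 ⟨σ₀ ^ n, hgσ.symm⟩
    have hdetg : (g : Matrix (Fin 2) (Fin 2) ℤ_[ℓ]).det = 1 := hall g hgG hg3
    -- `det ρ(σ₀)ⁿ = ι(det g) = 1`
    have h1 : (((ρ σ₀ : GL (Fin 2) ℚ_[ℓ]) : Matrix (Fin 2) (Fin 2) ℚ_[ℓ]).det) ^ n = 1 := by
      rw [← Matrix.det_pow, ← Units.val_pow_eq_pow_val, ← map_pow, ← hgσ, coe_map_coeRingHom]
      have e := RingHom.map_det (PadicInt.Coe.ringHom (p := ℓ)) (g : Matrix (Fin 2) (Fin 2) ℤ_[ℓ])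
      rw [RingHom.mapMatrix_apply] at e
      rw [hdetg, map_one] at e
      exact e.symm
    rw [hdet₀, ← pow_mul] at h1
    have h2 : ((p₀ ^ (m * n) : ℕ) : ℚ_[ℓ]) = 1 := by exact_mod_cast h1
    have h3 : p₀ ^ (m * n) = 1 := by exact_mod_cast h2
    have h4 : 1 < p₀ ^ (m * n) := Nat.one_lt_pow (Nat.pos_iff_ne_zero.1 (Nat.mul_pos hm1 hn)) hp₀.one_lt
    omega
  /- (1) no invariant line on `G ∩ Γ(ℓ³)` over `\bar ℚ_ℓ` -/
  set E := AlgebraicClosure ℚ_[ℓ] with hEdef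
  have hsq : ∀ d : ℚ_[ℓ], ∃ μ : E, μ * μ = algebraMap ℚ_[ℓ] E d := fun d ↦ by
    obtain ⟨μ, hμ⟩ := IsAlgClosed.exists_eq_mul_self (algebraMap ℚ_[ℓ] E d)
    exact ⟨μ, hμ.symm⟩
  have hirr : ∀ v : Fin 2 → E, v ≠ 0 → ∃ g ∈ G, g ∈ GL2.congruenceSubgroup (p := ℓ) 3 ∧
      ¬ ∃ c : E, (((g : Matrix (Fin 2) (Fin 2) ℤ_[ℓ]).map ((↑) : ℤ_[ℓ] → ℚ_[ℓ])).map (algebraMap ℚ_[ℓ] E)) *ᵥ v = c • v := by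
    intro v hv
    by_contra hall
    push Not at hall
    -- the base change `r = ρ_E` and the normal core `V` of `U`
    set r : absoluteGaloisGroup ℚ →* GL (Fin 2) E :=
      (Matrix.GeneralLinearGroup.map (algebraMap ℚ_[ℓ] E)).comp ρ.toMonoidHom with hr
    have hrapply : ∀ τ, ((r τ : GL (Fin 2) E) : Matrix (Fin 2) (Fin 2) E) =
        (((ρ τ : GL (Fin 2) ℚ_[ℓ]) : Matrix (Fin 2) (Fin 2) ℚ_[ℓ])).map (algebraMap ℚ_[ℓ] E) := fun τ ↦ rfl
    set V : Subgroup (absoluteGaloisGroup ℚ) := U.normalCore with hV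
    haveI : V.Normal := Subgroup.normalCore_normal U
    have hVU : V ≤ U := Subgroup.normalCore_le U
    have hVopen : IsOpen (V : Set (absoluteGaloisGroup ℚ)) := isOpen_normalCore U hUopen
    -- `V` fixes the line `E v`
    have hVline : ∀ τ ∈ V, ∃ c : E, ((r τ : GL (Fin 2) E) : Matrix (Fin 2) (Fin 2) E) *ᵥ v = c • v := by
      intro τ hτ
      obtain ⟨g, hg3, hgτ⟩ := hmemU.1 (hVU hτ)
      have hgG : g ∈ G := hmemG.2 ⟨τ, hgτ.symm⟩
      obtain ⟨c, hc⟩ := hall g hgG hg3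
      refine ⟨c, ?_⟩
      rw [hrapply, ← hgτ, coe_map_coeRingHom]
      exact hc
    -- `Γ_ℚ` has no invariant line (absolute irreducibility, Ribet's Thm. (2.3))
    have habs : GaloisRepresentations.FramedRep.IsAbsolutelyIrreducible ρ :=
      Ribet1977.isAbsolutelyIrreducible_of_thm23 (h23 N k) hf (by omega) hρ
    have hnoline : ∀ w : Fin 2 → E, w ≠ 0 → ∃ γ : absoluteGaloisGroup ℚ,
        ¬ ∃ c : E, ((r γ : GL (Fin 2) E) : Matrix (Fin 2) (Fin 2) E) *ᵥ w = c • w := by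
      intro w hw
      obtain ⟨γ, hγ⟩ := exists_not_eigenline_of_isAbsolutelyIrreducible habs (algebraMap ℚ_[ℓ] E) w hw
      exact ⟨γ, by rw [hrapply]; exact hγ⟩
    -- Clifford theory
    rcases scalar_or_index_two_of_eigenline r V hnoline hv hVline with hscalar | ⟨H, hVH, hHind, hHtr⟩
    · /- (A) `ρ(V)` scalar: a Frobenius in `V` gives `a_p² = 4 p^{k-1}` -/
      set S : Set (HeightOneSpectrum (𝓞 ℚ)) := {v | ((primesEquiv v : Nat.Primes) : ℕ) ∣ N * ℓ} with hSdef
      have hS : S.Finite := by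
        have hfin : {n : ℕ | n ∣ N * ℓ}.Finite :=
          (N * ℓ).divisors.finite_toSet.subset fun n hn ↦
            Nat.mem_divisors.mpr ⟨hn, mul_ne_zero (NeZero.ne N) hℓ.ne_zero⟩
        refine (hfin.preimage (f := fun v : HeightOneSpectrum (𝓞 ℚ) ↦ ((primesEquiv v : Nat.Primes) : ℕ))
          fun v _ w _ h ↦ primesEquiv.injective (Subtype.ext h)).subset ?_
        intro v hv
        exact hv
      have hdense := absoluteGaloisGroup.frobenius_dense Automorphic.chebotarev_artinRep_holds ℚ S hS
      obtain ⟨σ, hσV, w, hwS, 𝔓, h𝔓, hσ⟩ := hdense.inter_open_nonempty _ hVopen ⟨1, V.one_mem⟩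
      obtain ⟨⟨q, hq, htr⟩, hdetσ⟩ := hgood (v := w) hwS h𝔓 hσ
      obtain ⟨c, hc⟩ := hscalar σ hσV
      -- trace and determinant of the scalar `c`
      have htrE : algebraMap ℚ_[ℓ] E (q : ℚ_[ℓ]) = 2 * c := by
        rw [← htr, ← trace_map_fin_two, ← hrapply, hc, Matrix.trace_smul, Matrix.trace_one, Fintype.card_fin,
          smul_eq_mul]
        push_cast
        ring
      have hdetE : algebraMap ℚ_[ℓ] E ((((primesEquiv w : Nat.Primes) : ℕ) : ℚ_[ℓ]) ^ m) = c * c := by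
        rw [← hdetσ, RingHom.map_det, RingHom.mapMatrix_apply, ← hrapply, hc, Matrix.det_smul, Matrix.det_one,
          Fintype.card_fin, mul_one, pow_two]
      have hsqE : algebraMap ℚ_[ℓ] E ((q : ℚ_[ℓ]) ^ 2) =
          algebraMap ℚ_[ℓ] E (4 * (((primesEquiv w : Nat.Primes) : ℕ) : ℚ_[ℓ]) ^ m) := by
        rw [map_pow, htrE, map_mul, hdetE, map_ofNat]
        ring
      have hsqQℓ : ((q : ℚ_[ℓ])) ^ 2 = 4 * (((primesEquiv w : Nat.Primes) : ℕ) : ℚ_[ℓ]) ^ m :=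
        (algebraMap ℚ_[ℓ] E).injective hsqE
      have hsqQ : q ^ 2 = 4 * (((primesEquiv w : Nat.Primes) : ℕ) : ℚ) ^ m := by
        have h : ((q ^ 2 : ℚ) : ℚ_[ℓ]) = ((4 * (((primesEquiv w : Nat.Primes) : ℕ) : ℚ) ^ m : ℚ) : ℚ_[ℓ]) := by
          push_cast
          exact hsqQℓ
        exact_mod_cast h
      exact sq_ne_four_mul_prime_pow (primesEquiv w).2 hmodd q hsqQ
    · /- (B) the stabiliser `H` of index `2`: a quadratic character with `a_p = 0` off `H` -/
      have hHopen : IsOpen (H : Set (absoluteGaloisGroup ℚ)) := Subgroup.isOpen_mono hVH hVopen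
      -- the sign character `ψ` of `H`
      have hsignmul : ∀ a b : absoluteGaloisGroup ℚ,
          (if a * b ∈ H then (1 : ℂˣ) else -1) = (if a ∈ H then (1 : ℂˣ) else -1) * (if b ∈ H then 1 else -1) := by
        intro a b
        by_cases ha : a ∈ H <;> by_cases hb : b ∈ H
        · simp [ha, hb, H.mul_mem ha hb]
        · have : a * b ∉ H := fun h ↦ hb ((Subgroup.mul_mem_iff_of_index_two hHind).1 h |>.1 ha)
          simp [ha, hb, this]
        · have : a * b ∉ H := fun h ↦ ha ((Subgroup.mul_mem_iff_of_index_two hHind).1 h |>.2 hb)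
          simp [ha, hb, this]
        · have : a * b ∈ H := (Subgroup.mul_mem_iff_of_index_two hHind).2 (iff_of_false ha hb)
          simp [ha, hb, this]
      set ψ : absoluteGaloisGroup ℚ →* ℂˣ := MonoidHom.mk' (fun τ ↦ if τ ∈ H then 1 else -1) hsignmul with hψ
      have hψ_apply : ∀ τ, ψ τ = if τ ∈ H then 1 else -1 := fun τ ↦ rfl
      have hneg1 : (-1 : ℂˣ) ≠ 1 := by
        intro h
        have h' := congrArg (fun u : ℂˣ ↦ (u : ℂ)) h
        norm_num at h'
      have hψker : ((ψ.ker : Subgroup (absoluteGaloisGroup ℚ)) : Set (absoluteGaloisGroup ℚ)) = H := by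
        ext τ
        rw [SetLike.mem_coe, MonoidHom.mem_ker, hψ_apply, SetLike.mem_coe]
        by_cases h : τ ∈ H
        · simp [h]
        · simp [h, hneg1]
      have hkeropen : IsOpen ((ψ.ker : Subgroup (absoluteGaloisGroup ℚ)) : Set (absoluteGaloisGroup ℚ)) := by
        rw [hψker]; exact hHopen
      -- Kronecker–Weber: `ψ(Frob_p) = η(p)` for a Dirichlet character `η` modulo `n`, `p ∤ n`
      obtain ⟨n, _, ηc, hηval⟩ := exists_dirichletCharacter_of_kroneckerWeber KroneckerWeber_holds ψ hkeropen
      -- Frobenius elements at primes `∤ n N ℓ` are dense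
      set S' : Set (HeightOneSpectrum (𝓞 ℚ)) := {v | ((primesEquiv v : Nat.Primes) : ℕ) ∣ n * (N * ℓ)} with hS'def
      have hnNℓ : n * (N * ℓ) ≠ 0 := mul_ne_zero (NeZero.ne n) (mul_ne_zero (NeZero.ne N) hℓ.ne_zero)
      have hS' : S'.Finite := by
        have hfin : {q : ℕ | q ∣ n * (N * ℓ)}.Finite :=
          (n * (N * ℓ)).divisors.finite_toSet.subset fun q hq ↦ Nat.mem_divisors.mpr ⟨hq, hnNℓ⟩
        refine (hfin.preimage (f := fun v : HeightOneSpectrum (𝓞 ℚ) ↦ ((primesEquiv v : Nat.Primes) : ℕ))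
          fun v _ w _ h ↦ primesEquiv.injective (Subtype.ext h)).subset ?_
        intro v hv
        exact hv
      have hdense := absoluteGaloisGroup.frobenius_dense Automorphic.chebotarev_artinRep_holds ℚ S' hS'
      -- the value of `η` at a Frobenius above `p ∤ n N ℓ`
      have hηfrob : ∀ {w : HeightOneSpectrum (𝓞 ℚ)}, w ∉ S' → ∀ {𝔓}, 𝔓 ∈ w.primesAbove → ∀ {σ},
          IsArithFrobAt (𝓞 ℚ) σ 𝔓 → ηc ((((primesEquiv w : Nat.Primes) : ℕ)) : ZMod n) = if σ ∈ H then 1 else -1 := by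
        intro w hw 𝔓 h𝔓 σ hσ
        have hpn : ¬ ((primesEquiv w : Nat.Primes) : ℕ) ∣ n := fun h ↦ hw (h.mul_right _)
        have hw' : 𝔓 ∈ (primesEquiv.symm ⟨((primesEquiv w : Nat.Primes) : ℕ), (primesEquiv w).2⟩ :
            HeightOneSpectrum (𝓞 ℚ)).primesAbove := by
          have : (primesEquiv.symm ⟨((primesEquiv w : Nat.Primes) : ℕ), (primesEquiv w).2⟩ : HeightOneSpectrum (𝓞 ℚ)) = w := by
            rw [Subtype.coe_eta, Equiv.symm_apply_apply]
          rw [this]; exact h𝔓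
        have h := hηval _ (primesEquiv w).2 hpn 𝔓 hw' σ hσ
        rw [← h, hψ_apply]
        split_ifs <;> simp
      -- `η ≠ 1`: a Frobenius outside `H`
      have hne : ηc ≠ 1 := by
        obtain ⟨τ₀, hτ₀⟩ : ∃ τ₀, τ₀ ∉ H := by
          by_contra hall'
          push Not at hall'
          have : H = ⊤ := eq_top_iff.2 fun τ _ ↦ hall' τ
          rw [this, Subgroup.index_top] at hHind
          exact absurd hHind (by norm_num)
        have hHclosed : IsClosed (H : Set (absoluteGaloisGroup ℚ)) := H.isClosed_of_isOpen hHopen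
        obtain ⟨σ₁, hσ₁H, w₁, hw₁S, 𝔓₁, h𝔓₁, hσ₁⟩ :=
          hdense.inter_open_nonempty _ hHclosed.isOpen_compl ⟨τ₀, hτ₀⟩
        have hσ₁H' : σ₁ ∉ H := hσ₁H
        have hval := hηfrob hw₁S h𝔓₁ hσ₁
        rw [if_neg hσ₁H'] at hval
        intro h1
        rw [h1] at hval
        have hu : IsUnit ((((primesEquiv w₁ : Nat.Primes) : ℕ)) : ZMod n) :=
          (ZMod.isUnit_iff_coprime _ n).2 ((Nat.Prime.coprime_iff_not_dvd (primesEquiv w₁).2).2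
            fun h ↦ hw₁S (h.mul_right _))
        rw [MulChar.one_apply hu] at hval
        norm_num at hval
      -- `f` has complex multiplication by `η`: contradiction
      apply hCM
      refine ⟨n, ηc, hne, ?_⟩
      rw [Filter.eventually_cofinite]
      refine ((n * (N * ℓ)).divisors.finite_toSet).subset fun p hp ↦ ?_
      simp only [Set.mem_setOf_eq, Classical.not_imp] at hp
      obtain ⟨hpprime, hpne⟩ := hp
      rw [Finset.mem_coe, Nat.mem_divisors]
      refine ⟨?_, hnNℓ⟩
      by_contra hpn
      apply hpne
      set w : HeightOneSpectrum (𝓞 ℚ) := primesEquiv.symm ⟨p, hpprime⟩ with hwdef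
      have hpw : ((primesEquiv w : Nat.Primes) : ℕ) = p := by rw [hwdef, Equiv.apply_symm_apply]
      have hwS : w ∉ S' := by
        change ¬ ((primesEquiv w : Nat.Primes) : ℕ) ∣ n * (N * ℓ)
        rw [hpw]; exact hpn
      have hpNℓ : ¬ p ∣ N * ℓ := fun h ↦ hpn (h.mul_left n)
      obtain ⟨𝔓, h𝔓⟩ := HeightOneSpectrum.primesAbove_nonempty w
      obtain ⟨σ, hσ⟩ := HeightOneSpectrum.exists_isArithFrobAt_of_mem_primesAbove_holds (K := ℚ) (v := w) h𝔓
      obtain ⟨⟨q, hq, htr⟩, -⟩ := hgood (v := w) (by rw [hpw]; exact hpNℓ) h𝔓 hσ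
      have hval := hηfrob hwS h𝔓 hσ
      rw [hpw] at hval hq
      by_cases hσH : σ ∈ H
      · rw [if_pos hσH] at hval
        rw [hval, one_mul]
      · -- `tr ρ(σ) = 0`, so `a_p = 0`
        have h0 := hHtr σ hσH
        rw [hrapply, trace_map_fin_two, htr, map_eq_zero] at h0
        have hq0 : q = 0 := by exact_mod_cast h0
        rw [hq0, Rat.cast_zero] at hq
        have hq' : (qExpansion 1 ⇑f).coeff p = 0 := hq.symm
        rw [hq', mul_zero]
  /- conclusion: the engine and successive approximation -/
  obtain ⟨s, hs2, hmeet⟩ := exists_meets_of_forall_exists_not_eigenline_of_det_ne_one hsq hirr hdet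
  refine isOpen_range_of_meets ρ hs2 fun a ↦ ?_
  obtain ⟨g, hgG, hga⟩ := hmeet a
  obtain ⟨τ, hτ⟩ := hmemG.1 hgG
  exact ⟨g, ⟨τ, hτ⟩, hga⟩

end OpenImage

/-- **Open image for rational non-CM newforms (Serre, Swinnerton-Dyer; Ribet; Momose — as recorded
in Ribet 1985, Introduction (1) and §3, p. 191): discharge of the named fact
`momose_isOpen_range_galoisRep`.**  For a newform `f ∈ S_k(Γ₁(N))`, `k ≥ 2`, with `K_f = ℚ` and
without complex multiplication, every continuous `ρ : Γ_ℚ → GL₂(ℚ_ℓ)` attached to `f` away from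
`N ℓ` has open image — `OpenImage.momose_isOpen_range_galoisRep_of_thm23` with Ribet's
irreducibility theorem `Ribet1977.thm23_isIrreducible_holds`.
[cite: Ribet1985, §3 p. 191 (Momose's theorem) and Introduction (1)]
[cite: Ribet1977Nebentypus, Thm. (2.3), §4, Thm. (5.7)] -/
theorem momose_isOpen_range_galoisRep_holds : momose_isOpen_range_galoisRep :=
  OpenImage.momose_isOpen_range_galoisRep_of_thm23
    (fun N _ k ↦ Ribet1977.thm23_isIrreducible_holds (N := N) (k := k))

end Literature.NumberTheory.EllipticCurves.ModularForms
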